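import Mathlib
import Literature.MathematicalPhysics.QuantumFieldTheory.YangMillsOS
import Literature.MathematicalPhysics.QuantumFieldTheory.SpeciesLatticeProducts
import Literature.MathematicalPhysics.QuantumFieldTheory.LatticeGaugeProofs
import Literature.MathematicalPhysics.QuantumLattice.WilsonFeynmanHellmann
import HarnessLib

/-!
# Line `Sketch` (holomorphic coupling response) of crux `HypercubicLimit` — stub 2.4:
# a modulation-scale-free holomorphy radius forces a trivial response

Support file for crux `stmt-QuantumFields-16154` (`CoincidenceRotationBootstrap.HypercubicLimit` =
`MirrorModularBoosts.WeakCouplingHypercubicLimit`), line `Sketch` (card `holomorphic-coupling-response`),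
registered stub `stub_typedResponseVacuous` of `Cruxes/HypercubicLimit/Lines/Sketch.lean`.

The card's transfer target as typed (`UniformHolomorphicResponse`: holomorphy of the coupling-modulated
one-point function on a polydisc of radius `ε₁/(n+1)` INDEPENDENT of the modulating test functions, with
a bound linear in ONE Schwartz seminorm of each of them) is vacuous.  The mechanism, isolated here at
order one: if for one pair `(f₀, f₁)` and EVERY scale `c > 0` the response
`t ↦ ⟨Φ_k(f₀)⟩_{k, t·(c f₁)} = (∫ Φ_k(f₀) e^{t Φ_k(c f₁)} dμ_k)/(∫ e^{t Φ_k(c f₁)} dμ_k)` is holomorphic on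
the same disc `|t| < ε` with a bound `c · B`, then — `Φ_k` being linear in the test function — the
response to `f₁` itself is an ENTIRE function of at most linear growth; it is bounded on the real axis
(a tilted expectation of the bounded `Φ_k(f₀)`), so by Cauchy's estimate and Liouville it is constant,
and its derivative at `0`, which is the covariance `Cov_k(Φ_k(f₀), Φ_k(f₁))` (fluctuation–response), is
zero.

* `deriv_eq_zero_of_linear_growth_of_bounded_on_real` — the complex-analysis lemma;
* `response_ofReal`, `hasDerivAt_integral_tilted_zero` — the complex response on the real axis is the
  tilted expectation, whose derivative at `0` is the covariance;
* `covariance_eq_zero_of_scaleFree_holomorphy` — the abstract probabilistic statement;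
* `stub_typedResponseVacuous` — the registered stub (tree vocabulary).
-/

noncomputable section

open scoped SchwartzMap
open MeasureTheory ProbabilityTheory Filter Topology Complex Metric Set
open Literature.MathematicalPhysics.QuantumLattice Literature.MathematicalPhysics.QuantumFieldTheory

namespace Summit.QuantumFields.YangMills.Cruxes.HypercubicLimit.CouplingResponse

/-! ### Complex analysis: linear growth + bounded on `ℝ` ⇒ derivative zero -/

/-- An entire function of at most linear growth has a bounded derivative (Cauchy's estimate on circles
of radius `R → ∞`). [folklore] -/
theorem norm_deriv_le_of_linear_growth {Q : ℂ → ℂ} (hQ : Differentiable ℂ Q) {A B : ℝ}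
    (hgrowth : ∀ z, ‖Q z‖ ≤ A + B * ‖z‖) (z : ℂ) : ‖deriv Q z‖ ≤ |B| := by
  refine le_of_forall_pos_lt_add fun δ hδ => ?_
  set C : ℝ := |A| + |B| * ‖z‖ with hC
  have hC0 : 0 ≤ C := by positivity
  set R : ℝ := C / δ + 1 with hR
  have hRpos : 0 < R := by positivity
  have hsphere : ∀ w ∈ sphere z R, ‖Q w‖ ≤ C + |B| * R := by
    intro w hw
    have hw' : ‖w‖ ≤ ‖z‖ + R := by
      have h1 : ‖w - z‖ = R := by rw [← dist_eq_norm]; exact hw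
      calc ‖w‖ = ‖(w - z) + z‖ := by rw [sub_add_cancel]
        _ ≤ ‖w - z‖ + ‖z‖ := norm_add_le _ _
        _ = ‖z‖ + R := by rw [h1, add_comm]
    calc ‖Q w‖ ≤ A + B * ‖w‖ := hgrowth w
      _ ≤ |A| + |B| * ‖w‖ := add_le_add (le_abs_self A) (by
          calc B * ‖w‖ ≤ |B * ‖w‖| := le_abs_self _
            _ = |B| * ‖w‖ := by rw [abs_mul, abs_norm])
      _ ≤ |A| + |B| * (‖z‖ + R) := by gcongr
      _ = C + |B| * R := by rw [hC]; ring
  have hest := Complex.norm_deriv_le_of_forall_mem_sphere_norm_le hRpos hQ.diffContOnCl hsphere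
  refine hest.trans_lt ?_
  rw [div_lt_iff₀ hRpos]
  have hCR : C < δ * R := by
    rw [hR, mul_add, mul_div_cancel₀ _ hδ.ne', mul_one]
    linarith
  nlinarith [hCR, abs_nonneg B, hRpos]

/-- **Linear growth + bounded on the real axis ⇒ zero derivative.**  An entire function `Q` with
`‖Q z‖ ≤ A + B‖z‖` everywhere and `‖Q t‖ ≤ M` for all real `t` has `Q' ≡ const = 0`; in particular
`deriv Q 0 = 0`.  (Cauchy: `Q'` bounded; Liouville: `Q'` constant `= c`; so `Q t = Q 0 + c t`, bounded
on `ℝ` only if `c = 0`.) [folklore] -/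
theorem deriv_eq_zero_of_linear_growth_of_bounded_on_real {Q : ℂ → ℂ} (hQ : Differentiable ℂ Q)
    {A B M : ℝ} (hgrowth : ∀ z, ‖Q z‖ ≤ A + B * ‖z‖) (hreal : ∀ t : ℝ, ‖Q t‖ ≤ M) :
    deriv Q 0 = 0 := by
  -- Q' is entire and bounded, hence constant
  have hQ' : Differentiable ℂ (deriv Q) := fun z => ((hQ.analyticAt z).deriv).differentiableAt
  have hbd : Bornology.IsBounded (range (deriv Q)) := by
    rw [isBounded_iff_forall_norm_le]
    refine ⟨|B|, ?_⟩
    rintro _ ⟨z, rfl⟩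
    exact norm_deriv_le_of_linear_growth hQ hgrowth z
  set c := deriv Q 0 with hc
  have hconst : ∀ z, deriv Q z = c := fun z => hQ'.apply_eq_apply_of_bounded hbd z 0
  -- Q z = Q 0 + c z
  have haffine : ∀ z, Q z - c * z = Q 0 := by
    intro z
    have hd : Differentiable ℂ (fun w => Q w - c * w) := hQ.sub (differentiable_id.const_mul c)
    have hd0 : ∀ w, deriv (fun w => Q w - c * w) w = 0 := by
      intro w
      have hw : HasDerivAt (fun w => Q w - c * w) (deriv Q w - c * 1) w :=
        (hQ w).hasDerivAt.sub ((hasDerivAt_id w).const_mul c)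
      rw [hw.deriv, hconst w]
      ring
    have := is_const_of_deriv_eq_zero hd hd0 z 0
    simpa using this
  -- bounded on ℝ ⇒ c = 0
  by_contra hne
  have hcpos : 0 < ‖c‖ := norm_pos_iff.2 hne
  set t : ℝ := (M + ‖Q 0‖ + 1) / ‖c‖ with ht
  have htpos : 0 < t := by
    have : 0 ≤ M := (norm_nonneg _).trans (hreal 0)
    positivity
  have h1 : ‖c * (t : ℂ)‖ ≤ ‖Q (t : ℂ)‖ + ‖Q 0‖ := by
    have := haffine (t : ℂ)
    have h' : c * (t : ℂ) = Q (t : ℂ) - Q 0 := by rw [← this]; ring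
    rw [h']
    exact norm_sub_le _ _
  have h2 : ‖c * (t : ℂ)‖ = M + ‖Q 0‖ + 1 := by
    rw [norm_mul, Complex.norm_real, Real.norm_of_nonneg htpos.le, ht]
    field_simp
  have h3 := hreal t
  linarith

/-! ### The complex one-source response of a tilted probability measure on the real axis -/

section Response

variable {Ω : Type*} [MeasurableSpace Ω] {μ : Measure Ω} [IsProbabilityMeasure μ] {X Y : Ω → ℝ}

omit [IsProbabilityMeasure μ] in
/-- The complex partition function at a real source is the (real) moment generating function. [folklore] -/
theorem integral_cexp_ofReal_mul (Y : Ω → ℝ) (t : ℝ) :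
    ∫ ω, Complex.exp ((t : ℂ) * ((Y ω : ℝ) : ℂ)) ∂μ = ((mgf Y μ t : ℝ) : ℂ) := by
  have h : (fun ω => Complex.exp ((t : ℂ) * ((Y ω : ℝ) : ℂ))) =
      fun ω => ((Real.exp (t * Y ω) : ℝ) : ℂ) := by
    funext ω
    rw [Complex.ofReal_exp]
    push_cast
    ring_nf
  rw [h, integral_complex_ofReal]
  rfl

omit [IsProbabilityMeasure μ] in
/-- The complex numerator at a real source is the real one. [folklore] -/
theorem integral_ofReal_mul_cexp_ofReal_mul (X Y : Ω → ℝ) (t : ℝ) :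
    ∫ ω, ((X ω : ℝ) : ℂ) * Complex.exp ((t : ℂ) * ((Y ω : ℝ) : ℂ)) ∂μ =
      ((∫ ω, X ω * Real.exp (t * Y ω) ∂μ : ℝ) : ℂ) := by
  have h : (fun ω => ((X ω : ℝ) : ℂ) * Complex.exp ((t : ℂ) * ((Y ω : ℝ) : ℂ))) =
      fun ω => ((X ω * Real.exp (t * Y ω) : ℝ) : ℂ) := by
    funext ω
    push_cast
    ring_nf
  rw [h, integral_complex_ofReal]

omit [IsProbabilityMeasure μ] in
/-- **The complex response on the real axis is the tilted expectation**:
`(∫ X e^{tY} dμ)/(∫ e^{tY} dμ) = ∫ X d(μ.tilted (tY))` for real `t` (both sides coerced to `ℂ`).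
[folklore] -/
theorem response_ofReal (X Y : Ω → ℝ) (t : ℝ) :
    (∫ ω, ((X ω : ℝ) : ℂ) * Complex.exp ((t : ℂ) * ((Y ω : ℝ) : ℂ)) ∂μ) /
        ∫ ω, Complex.exp ((t : ℂ) * ((Y ω : ℝ) : ℂ)) ∂μ =
      ((∫ ω, X ω ∂(μ.tilted (t * Y ·)) : ℝ) : ℂ) := by
  rw [integral_cexp_ofReal_mul, integral_ofReal_mul_cexp_ofReal_mul,
    integral_tilted_eq_integral_mul_exp_div_mgf, Complex.ofReal_div]

/-- **Fluctuation–response on the real axis**: for bounded measurable `X`, `Y` on a probability space the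
real function `t ↦ ∫ X d(μ.tilted (tY))` has derivative `Cov_μ(X, Y)` at `0`. [folklore] -/
theorem hasDerivAt_integral_tilted_zero (hX : Measurable X) (hY : Measurable Y) {CX CY : ℝ}
    (hbX : ∀ ω, |X ω| ≤ CX) (hbY : ∀ ω, |Y ω| ≤ CY) :
    HasDerivAt (fun t : ℝ => ∫ ω, X ω ∂(μ.tilted (t * Y ·))) (cov[X, Y; μ]) 0 := by
  have hset : integrableExpSet Y μ = Set.univ :=
    integrableExpSet_eq_univ_of_abs_le hY.aemeasurable (ae_of_all _ hbY)
  have h0 : (0 : ℝ) ∈ interior (integrableExpSet Y μ) := by rw [hset, interior_univ]; trivial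
  have h := hasDerivAt_integral_tilted_eq_covariance (μ := μ) (X := Y) (F := X) (C := CX) h0
    hX.aestronglyMeasurable (ae_of_all _ fun ω => by rw [Real.norm_eq_abs]; exact hbX ω)
  have htilt : μ.tilted (fun ω => (0 : ℝ) * Y ω) = μ := by
    simp only [zero_mul]
    exact tilted_zero μ
  rwa [htilt] at h

/-- The tilted expectation of a bounded function is bounded by the same constant. [folklore] -/
theorem abs_integral_tilted_le (hY : Measurable Y) {CX CY : ℝ} (hbX : ∀ ω, |X ω| ≤ CX)
    (hbY : ∀ ω, |Y ω| ≤ CY) (t : ℝ) : |∫ ω, X ω ∂(μ.tilted (t * Y ·))| ≤ CX := by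
  have hint : Integrable (fun ω => Real.exp (t * Y ω)) μ := by
    have hset : integrableExpSet Y μ = Set.univ :=
      integrableExpSet_eq_univ_of_abs_le hY.aemeasurable (ae_of_all _ hbY)
    have : t ∈ integrableExpSet Y μ := by rw [hset]; trivial
    exact this
  haveI : IsProbabilityMeasure (μ.tilted (t * Y ·)) := isProbabilityMeasure_tilted hint
  have h := norm_integral_le_of_norm_le_const (μ := μ.tilted (t * Y ·)) (f := X) (C := CX)
    (ae_of_all _ fun ω => by rw [Real.norm_eq_abs]; exact hbX ω)
  rwa [Real.norm_eq_abs, probReal_univ, mul_one] at h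

/-- **Scale-free holomorphy radius ⇒ trivial response** (abstract form).  On a probability space let
`X`, `Y` be bounded measurable, and suppose that for every `c > 0` the complex response of `X` to the
source `c Y`, `t ↦ (∫ X e^{t c Y})/(∫ e^{t c Y})`, is complex-differentiable on the disc `|t| < ε` and
bounded there by `c · B`.  Then `Cov(X, Y) = 0`. [folklore] -/
theorem covariance_eq_zero_of_scaleFree_holomorphy (hX : Measurable X) (hY : Measurable Y)
    {CX CY : ℝ} (hbX : ∀ ω, |X ω| ≤ CX) (hbY : ∀ ω, |Y ω| ≤ CY) {ε B : ℝ} (hε : 0 < ε)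
    (h : ∀ c : ℝ, 0 < c →
      DifferentiableOn ℂ
        (fun t : ℂ => (∫ ω, ((X ω : ℝ) : ℂ) * Complex.exp (t * (((c * Y ω : ℝ)) : ℂ)) ∂μ) /
          ∫ ω, Complex.exp (t * (((c * Y ω : ℝ)) : ℂ)) ∂μ) (ball 0 ε) ∧
      ∀ t ∈ ball (0 : ℂ) ε,
        ‖(∫ ω, ((X ω : ℝ) : ℂ) * Complex.exp (t * (((c * Y ω : ℝ)) : ℂ)) ∂μ) /
          ∫ ω, Complex.exp (t * (((c * Y ω : ℝ)) : ℂ)) ∂μ‖ ≤ c * B) :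
    cov[X, Y; μ] = 0 := by
  -- the response to `Y` itself
  set Q : ℂ → ℂ := fun t => (∫ ω, ((X ω : ℝ) : ℂ) * Complex.exp (t * ((Y ω : ℝ) : ℂ)) ∂μ) /
      ∫ ω, Complex.exp (t * ((Y ω : ℝ) : ℂ)) ∂μ with hQdef
  -- the response to `c Y` is `Q (t c)`
  have hscale : ∀ (c : ℝ) (t : ℂ),
      (∫ ω, ((X ω : ℝ) : ℂ) * Complex.exp (t * (((c * Y ω : ℝ)) : ℂ)) ∂μ) /
          ∫ ω, Complex.exp (t * (((c * Y ω : ℝ)) : ℂ)) ∂μ = Q (t * c) := by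
    intro c t
    simp only [hQdef]
    congr 1
    · refine integral_congr_ae (ae_of_all _ fun ω => ?_)
      push_cast; ring_nf
    · refine integral_congr_ae (ae_of_all _ fun ω => ?_)
      push_cast; ring_nf
  -- Q is entire with linear growth
  have hdiff : Differentiable ℂ Q ∧ ∀ z, ‖Q z‖ ≤ 2 * B / ε + (2 * B / ε) * ‖z‖ := by
    have key : ∀ z : ℂ, DifferentiableAt ℂ Q z ∧ ‖Q z‖ ≤ 2 * B / ε + (2 * B / ε) * ‖z‖ := by
      intro z
      set c : ℝ := 2 * (‖z‖ + 1) / ε with hc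
      have hcpos : 0 < c := by positivity
      obtain ⟨hD, hB⟩ := h c hcpos
      have hmem : ∀ w : ℂ, ‖w‖ < ‖z‖ + 1 → w / c ∈ ball (0 : ℂ) ε := by
        intro w hw
        rw [mem_ball, dist_zero_right, norm_div, Complex.norm_real, Real.norm_of_nonneg hcpos.le,
          div_lt_iff₀ hcpos, hc]
        calc ‖w‖ < ‖z‖ + 1 := hw
          _ < ε * (2 * (‖z‖ + 1) / ε) := by
            rw [mul_div_assoc', mul_comm ε, mul_div_assoc, div_self hε.ne', mul_one]
            linarith [norm_nonneg z]
      have hzmem : z / c ∈ ball (0 : ℂ) ε := hmem z (lt_add_one _)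
      set Qc : ℂ → ℂ := fun t : ℂ => (∫ ω, ((X ω : ℝ) : ℂ) *
            Complex.exp (t * (((c * Y ω : ℝ)) : ℂ)) ∂μ) /
          ∫ ω, Complex.exp (t * (((c * Y ω : ℝ)) : ℂ)) ∂μ with hQc
      have hfun : Q = Qc ∘ fun w : ℂ => w / (c : ℂ) := by
        funext w
        simp only [Function.comp, hQc]
        rw [hscale c (w / c), div_mul_cancel₀ w (by exact_mod_cast hcpos.ne')]
      constructor
      · rw [hfun]
        refine (hD.differentiableAt (isOpen_ball.mem_nhds hzmem)).comp z ?_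
        exact ((hasDerivAt_id z).div_const (c : ℂ)).differentiableAt
      · have hb := hB (z / c) hzmem
        rw [hscale c, div_mul_cancel₀ z (by exact_mod_cast hcpos.ne')] at hb
        refine hb.trans (le_of_eq ?_)
        rw [hc]; ring
    exact ⟨fun z => (key z).1, fun z => (key z).2⟩
  -- Q is bounded on the real axis
  have hreal : ∀ t : ℝ, ‖Q t‖ ≤ CX := by
    intro t
    simp only [hQdef]
    rw [response_ofReal X Y t, Complex.norm_real, Real.norm_eq_abs]
    exact abs_integral_tilted_le hY hbX hbY t
  have hd0 : deriv Q 0 = 0 :=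
    deriv_eq_zero_of_linear_growth_of_bounded_on_real hdiff.1 hdiff.2 hreal
  -- the derivative at 0 along the real axis is the covariance
  have h1 : HasDerivAt (fun t : ℝ => Q (t : ℂ)) (deriv Q 0) 0 := by
    have := (hdiff.1 0).hasDerivAt
    rw [← Complex.ofReal_zero] at this
    exact this.comp_ofReal
  have h2 : HasDerivAt (fun t : ℝ => Q (t : ℂ)) ((cov[X, Y; μ] : ℝ) : ℂ) 0 := by
    have hq := (hasDerivAt_integral_tilted_zero (μ := μ) hX hY hbX hbY).ofReal_comp
    refine hq.congr_of_eventuallyEq (Eventually.of_forall fun t => ?_)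
    simp only [hQdef]
    exact response_ofReal X Y t
  have := h1.unique h2
  rw [hd0] at this
  exact_mod_cast this.symm

end Response

/-! ### The registered stub -/

/-- Linearity of the smeared lattice field in the test function (scalar multiples). [folklore] -/
theorem smearedLatticeField_smul {G : Type} [Group G] [MeasurableSpace G] (O : LGConfig 4 G → ℝ)
    (Λ : Finset (Literature.Probability.LatticeModels.Site 4)) (a c m : ℝ) (t : ℝ)
    (f : 𝓢(EuclideanSpace ℝ (Fin 4), ℝ)) (U : LGConfig 4 G) :
    smearedLatticeField O Λ a c m (t • f) U = t * smearedLatticeField O Λ a c m f U := by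
  unfold smearedLatticeField
  rw [Finset.mul_sum, Finset.mul_sum, Finset.mul_sum]
  refine Finset.sum_congr rfl fun x _ => ?_
  have h : (t • f) (a • siteToE x) = t * f (a • siteToE x) := rfl
  rw [h]
  ring

/-- **stub 2.4 — GUARD: a modulation-scale-free holomorphy radius forces a trivial response.**  If for
ONE pair `(f₀, f₁)` and every scale `c > 0` the order-1 complex-source response of the renormalised
curvature field `Φ_k(f₀)` to the coupling modulation `c • f₁` is holomorphic on the SAME disc `|t| < ε`
with a bound `c · B`, then `Cov_k(Φ_k(f₀), Φ_k(f₁)) = 0` under the step-`k` Wilson measure.  This is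
exactly what the card's typed `UniformHolomorphicResponse` grants (radius `ε₁/2` independent of `f₁`,
bound `C₀ C₁ |f₀|_{m,l} |c • f₁|_{m,l} = c · (C₀ C₁ |f₀| |f₁|)`), so the typed transfer target forces all
off-diagonal truncated two-point functions of the curvature to vanish at every `k` — incompatible, under
the crux's convergence clause, with its TwoPointNontrivial clause. [folklore] -/
theorem stub_typedResponseVacuous :
    ∀ (G : Type) [Group G] [TopologicalSpace G] [IsTopologicalGroup G] [CompactSpace G]
      [MeasurableSpace G] [BorelSpace G] (r : LatticeRep G) (sch : SpeciesScheme (YMSpecies G))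
      (k : ℕ) (f₀ f₁ : 𝓢(EuclideanSpace ℝ (Fin 4), ℝ)) (ε B : ℝ), 0 < ε →
      (∀ c : ℝ, 0 < c →
        DifferentiableOn ℂ
          (fun t : ℂ =>
            (∫ U, ((smearedLatticeField r.curvature.F
                (Literature.Probability.LatticeModels.box 4 (sch.L k)) (sch.a k) (sch.c r.curvature k)
                (sch.m r.curvature k) f₀ (torusLift (sch.side k) U) : ℝ) : ℂ) *
              Complex.exp (t * ((smearedLatticeField r.curvature.F
                (Literature.Probability.LatticeModels.box 4 (sch.L k)) (sch.a k) (sch.c r.curvature k)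
                (sch.m r.curvature k) (c • f₁) (torusLift (sch.side k) U) : ℝ) : ℂ))
              ∂(wilsonMeasure r.ρ (sch.β k) : Measure (GaugeConfig 4 (sch.side k) G))) /
            ∫ U, Complex.exp (t * ((smearedLatticeField r.curvature.F
                (Literature.Probability.LatticeModels.box 4 (sch.L k)) (sch.a k) (sch.c r.curvature k)
                (sch.m r.curvature k) (c • f₁) (torusLift (sch.side k) U) : ℝ) : ℂ))
              ∂(wilsonMeasure r.ρ (sch.β k) : Measure (GaugeConfig 4 (sch.side k) G)))
          (Metric.ball 0 ε) ∧
        ∀ t ∈ Metric.ball (0 : ℂ) ε,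
          ‖(∫ U, ((smearedLatticeField r.curvature.F
                (Literature.Probability.LatticeModels.box 4 (sch.L k)) (sch.a k) (sch.c r.curvature k)
                (sch.m r.curvature k) f₀ (torusLift (sch.side k) U) : ℝ) : ℂ) *
              Complex.exp (t * ((smearedLatticeField r.curvature.F
                (Literature.Probability.LatticeModels.box 4 (sch.L k)) (sch.a k) (sch.c r.curvature k)
                (sch.m r.curvature k) (c • f₁) (torusLift (sch.side k) U) : ℝ) : ℂ))
              ∂(wilsonMeasure r.ρ (sch.β k) : Measure (GaugeConfig 4 (sch.side k) G))) /
            ∫ U, Complex.exp (t * ((smearedLatticeField r.curvature.F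
                (Literature.Probability.LatticeModels.box 4 (sch.L k)) (sch.a k) (sch.c r.curvature k)
                (sch.m r.curvature k) (c • f₁) (torusLift (sch.side k) U) : ℝ) : ℂ))
              ∂(wilsonMeasure r.ρ (sch.β k) : Measure (GaugeConfig 4 (sch.side k) G))‖ ≤ c * B) →
      covariance
          (fun U => smearedLatticeField r.curvature.F
            (Literature.Probability.LatticeModels.box 4 (sch.L k)) (sch.a k) (sch.c r.curvature k)
            (sch.m r.curvature k) f₀ (torusLift (sch.side k) U))
          (fun U => smearedLatticeField r.curvature.F
            (Literature.Probability.LatticeModels.box 4 (sch.L k)) (sch.a k) (sch.c r.curvature k)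
            (sch.m r.curvature k) f₁ (torusLift (sch.side k) U))
          (wilsonMeasure r.ρ (sch.β k) : Measure (GaugeConfig 4 (sch.side k) G)) = 0 := by
  intro G _ _ _ _ _ _ r sch k f₀ f₁ ε B hε h
  haveI : IsProbabilityMeasure (wilsonMeasure r.ρ (sch.β k) : Measure (GaugeConfig 4 (sch.side k) G)) :=
    isProbabilityMeasure_wilsonMeasure (d := 4) (L := sch.side k) r.ρ r.continuous (sch.β k)
  set X : GaugeConfig 4 (sch.side k) G → ℝ := fun U => smearedLatticeField r.curvature.F
    (Literature.Probability.LatticeModels.box 4 (sch.L k)) (sch.a k) (sch.c r.curvature k)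
    (sch.m r.curvature k) f₀ (torusLift (sch.side k) U) with hX
  set Y : GaugeConfig 4 (sch.side k) G → ℝ := fun U => smearedLatticeField r.curvature.F
    (Literature.Probability.LatticeModels.box 4 (sch.L k)) (sch.a k) (sch.c r.curvature k)
    (sch.m r.curvature k) f₁ (torusLift (sch.side k) U) with hY
  have hXm : Measurable X := measurable_smearedLatticeField_torusLift r.curvature _ _ _ _ f₀ _
  have hYm : Measurable Y := measurable_smearedLatticeField_torusLift r.curvature _ _ _ _ f₁ _
  obtain ⟨CX, hCX⟩ := exists_bound_smearedLatticeField r.curvature.bounded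
    (Literature.Probability.LatticeModels.box 4 (sch.L k)) (sch.a k) (sch.c r.curvature k)
    (sch.m r.curvature k) f₀
  obtain ⟨CY, hCY⟩ := exists_bound_smearedLatticeField r.curvature.bounded
    (Literature.Probability.LatticeModels.box 4 (sch.L k)) (sch.a k) (sch.c r.curvature k)
    (sch.m r.curvature k) f₁
  refine covariance_eq_zero_of_scaleFree_holomorphy hXm hYm (fun U => hCX _) (fun U => hCY _) hε
    (B := B) fun c hc => ?_
  have hsm : ∀ U : GaugeConfig 4 (sch.side k) G, smearedLatticeField r.curvature.F
      (Literature.Probability.LatticeModels.box 4 (sch.L k)) (sch.a k) (sch.c r.curvature k)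
      (sch.m r.curvature k) (c • f₁) (torusLift (sch.side k) U) = c * Y U := fun U =>
    smearedLatticeField_smul _ _ _ _ _ c f₁ _
  obtain ⟨hD, hB⟩ := h c hc
  simp only [hsm] at hD hB
  exact ⟨hD, hB⟩

end Summit.QuantumFields.YangMills.Cruxes.HypercubicLimit.CouplingResponse

end
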